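import Literature.NumberTheory.EllipticCurves.ModPIrreducibleNotEisenstein
import Mathlib.FieldTheory.IsAlgClosed.AlgebraicClosure
import HarnessLib

/-!
# `E[p]` irreducible, `p` odd ⟹ `a_ℓ(E) mod p` not Eisenstein — the two consumed forms (proofs only)

Topic `NumberTheory/EllipticCurves`; theorems only (no definition, no named fact). Companion of
`ModPIrreducibleNotEisenstein`, whose ONE named fact
`Literature.NumberTheory.EllipticCurves.not_isEisensteinEigensystem_of_hasIrreducibleModPGaloisRep`
(Darmon–Diamond–Taylor 1995, Prop. 2.6 (b) / 2.8 (a) / 2.11 (a) / p. 87 / Lemma 4.12 — see that file's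
module docstring for the statements as printed and the four-line reading) is read here in the two
shapes its consumers use:

* `not_isEisensteinEigensystem_algebraMap_of_hasIrreducibleModPGaloisRep` — over `K̄ = AlgebraicClosure K`
  through `algebraMap K K̄` for any field `K` of characteristic `p`; with `K = ZMod p` and
  `λ ℓ = a_ℓ(E) mod p` this is literally the non-Eisenstein hypothesis
  `¬ IsEisensteinEigensystem 2 (fun ℓ => algebraMap K (AlgebraicClosure K) (λ ℓ))` of the cell
  `bsd-f2-manin` relative Ihara statement `RelativeIharaShiftVanishingBar` (es g10, MEMO-es §22.6) as
  consumed by the line provers' `shiftClassGenerationThree_of_relativeIhara` (`hNE′`);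
* `not_isNarrowEisensteinEigensystem_of_hasIrreducibleModPGaloisRep` — the one-character (narrow)
  form `(1 + ℓ) η(ℓ)` over any field of characteristic `p`
  (`IsNarrowEisensteinEigensystem.isEisensteinEigensystem`); for `η = 1`, `F = 𝔽_p` compare the tree's
  PROVED `not_irreducible_of_frobeniusTrace_congr_off_finite` (`ModPReducibilityAlmostAllProofs`).

## References

* H. Darmon, F. Diamond, R. Taylor, *Fermat's Last Theorem*, CDM 1995: Prop. 2.6 (b) p. 53,
  Prop. 2.8 (a) p. 56, Prop. 2.11 (a) p. 57, §3.1 p. 87, Lemma 4.12 p. 120. [DarmonDiamondTaylor1995]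
-/

noncomputable section

namespace Literature.NumberTheory.EllipticCurves

open Literature.NumberTheory.EllipticCurves.ModularForms

/-- The fact read over an algebraic closure through `algebraMap K K̄` of a field `K` of
characteristic `p` — the literal shape of the non-Eisenstein hypothesis of the cell's relative Ihara
statement (`K = ZMod p`, `λ ℓ = a_ℓ(E) mod p`): `algebraMap K K̄ (a_ℓ · 1_K) = a_ℓ · 1_{K̄}`.
[cite: DarmonDiamondTaylor1995, Lemma 4.12 p. 120] -/
theorem not_isEisensteinEigensystem_algebraMap_of_hasIrreducibleModPGaloisRep
    (h : not_isEisensteinEigensystem_of_hasIrreducibleModPGaloisRep)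
    (W : WeierstrassCurve ℚ) [W.IsElliptic] (p : ℕ) [Fact p.Prime] (hp : p ≠ 2)
    (hirr : W.HasIrreducibleModPGaloisRep p) (K : Type) [Field K] [CharP K p] :
    ¬ IsEisensteinEigensystem 2
      (fun ℓ : ℕ => algebraMap K (AlgebraicClosure K) (((W.LFunction ℓ : ℤ) : K))) := by
  have h' := h W p hp hirr (AlgebraicClosure K)
  simpa only [map_intCast] using h'

/-- The narrow (one-character) form over a field of characteristic `p` follows: a narrow-Eisenstein
system `(1 + ℓ) η(ℓ)` is Eisenstein with `ψ = φ = η`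
(`IsNarrowEisensteinEigensystem.isEisensteinEigensystem`). For `η = 1` and `F = 𝔽_p` this is the
tree's PROVED `not_irreducible_of_frobeniusTrace_congr_off_finite` read through `a_ℓ = W.LFunction ℓ`.
[cite: DarmonDiamondTaylor1995, Lemma 4.12 p. 120] -/
theorem not_isNarrowEisensteinEigensystem_of_hasIrreducibleModPGaloisRep
    (h : not_isEisensteinEigensystem_of_hasIrreducibleModPGaloisRep)
    (W : WeierstrassCurve ℚ) [W.IsElliptic] (p : ℕ) [Fact p.Prime] (hp : p ≠ 2)
    (hirr : W.HasIrreducibleModPGaloisRep p) (F : Type) [Field F] [CharP F p] :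
    ¬ IsNarrowEisensteinEigensystem 2 (fun ℓ : ℕ => ((W.LFunction ℓ : ℤ) : F)) :=
  fun hN => h W p hp hirr F hN.isEisensteinEigensystem

end Literature.NumberTheory.EllipticCurves

end
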